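import Mathlib
import Summits.Ventures.PercRepro2.RootCutSides

/-!
# The a₃-exploration fibres across the root pair: the fibres of `x` factor into an `S`-side cluster
event and an `R`-side event indexed by the root `x` reaches
(blind cell PercRepro2, night-1 g33; proofs/NIGHT1-G32.md §6 and NIGHT1-G33.md, the root-shield
identity; the sides are RootCutSides.lean, the sums RootCutSums.lean)

Let the roots separate `VR` from `VS` (`RootCut.IsRootCut ends a₁ a₂ ↑VR ↑VS ER ES`, `VR VS : Finset V`)
and let `x ∈ VS`.  On `Q` the cluster of `x` is its `S`-cluster `T ⊆ VS ∪ {a₁, a₂}` together with the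
`R`-cluster of the root in `T`, if any (`RootCut.cluster_eq_union_root`), so the fibre of the
`x`-exploration at `W = T ∪ W_R` (`T ⊆ VS ∪ {a₁, a₂}`, `W_R ⊆ VR`) is the product of the `S`-side
event `{C_S(x) = T} ∩ Q_S` and the `R`-side event `RE T W_R` (`{C_R(a) = insert a W_R} ∩ Q_R` for the
root `a ∈ T`; `Q_R` if `T` has no root and `W_R = ∅`; `∅` otherwise): `fibre_pair`.  The mark events
join the side of the mark (`fibre_pair_inter_conn_S`, `fibre_pair_inter_conn_R`) and every
probability factors (`prob_fibre_pair`, `prob_fibre_pair_inter_S`, `prob_fibre_pair_inter_R`).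
The `R`-side events `RE T W_R`, `W_R ⊆ VR`, partition `Q_R` for every `T` (`sum_prob_RE_inter`), and
the `S`-side cluster events `{C_S(x) = T}`, `T ⊆ VS ∪ {a₁, a₂}`, partition every `S`-side event
(`sum_prob_S_cluster_inter`).  Standard axioms.
-/

namespace Summit.Ventures.PercRepro2

open UnionCluster CovForm CutV

namespace CovForm

namespace A3Fibre

namespace RootShield

/-! ## The fibres of `x` on the pairs `(T, W_R)` -/

section Fibres

variable {V : Type*} {E : Type*} [Fintype V] [DecidableEq V] [Fintype E] [DecidableEq E]
  {ends : E → Sym2 V} {a₁ a₂ : V} {VR VS : Finset V} {ER ES : Set E} [DecidablePred (· ∈ ER)]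
  [DecidablePred (· ∈ ES)]

omit [Fintype V] [Fintype E] [DecidableEq E] in
/-- **The fibre of `x` factors (root case)**: for `T ⊆ VS ∪ {a₁, a₂}` containing the root `a` and
`W_R ⊆ VR`, `Q ∩ {C(x) = T ∪ W_R} = ({C_S(x) = T} ∩ Q)_S ∩ ({C_R(a) = insert a W_R} ∩ Q)_R`. -/
lemma fibre_pair_root (h : RootCut.IsRootCut ends a₁ a₂ ↑VR ↑VS ER ES) {x : V} (hx : x ∈ VS)
    {T : Finset V} (hT : T ⊆ insert a₁ (insert a₂ VS)) {W_R : Finset V} (hW : W_R ⊆ VR) {a : V}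
    (ha : a = a₁ ∨ a = a₂) (haT : a ∈ T) :
    fibre ends a₁ a₂ x (T ∪ W_R) =
      sideEvent ES (clusterEvent ends x (↑T : Set V) ∩ avoidAll ends a₂ {a₁}) ∩
        sideEvent ER (clusterEvent ends a (↑(insert a W_R) : Set V) ∩ avoidAll ends a₂ {a₁}) := by
  have haS : a ∈ (↑VS : Set V) ∪ {a₁, a₂} := by
    rcases ha with rfl | rfl
    · exact Or.inr (Or.inl rfl)
    · exact Or.inr (Or.inr rfl)
  ext ω
  simp only [fibre, Set.mem_inter_iff, mem_sideEvent, RootCut.mem_avoidAll_iff, mem_clusterEvent]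
  constructor
  · rintro ⟨hQ, hWω⟩
    obtain ⟨hR', hS'⟩ := (RootCut.not_conn_iff h).1 hQ
    have hxa : Conn ends (restrict ES ω) x a := by
      have h1 : a ∈ cluster ends ω x ∩ ((↑VS : Set V) ∪ {a₁, a₂}) := by
        refine ⟨?_, haS⟩
        rw [hWω]
        exact Finset.mem_coe.2 (Finset.mem_union_left _ haT)
      rw [cluster_inter_S h hQ hx] at h1
      exact h1
    refine ⟨⟨?_, hS'⟩, ⟨?_, hR'⟩⟩
    · rw [← cluster_inter_S h hQ hx, hWω, union_inter_S_eq h hT hW]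
    · rw [cluster_R_root_eq h hR' ha, ← cluster_inter_R_of_conn h hQ hx ha hxa, hWω,
        union_inter_R_eq h hT hW, Finset.coe_insert]
  · rintro ⟨⟨hTS, hS'⟩, ⟨hRa, hR'⟩⟩
    have hQ : ¬ Conn ends ω a₂ a₁ := (RootCut.not_conn_iff h).2 ⟨hR', hS'⟩
    refine ⟨hQ, ?_⟩
    have hR : ¬ Conn ends (restrict ER ω) a₁ a₂ := fun hc => hR' (conn_symm hc)
    have hS : ¬ Conn ends (restrict ES ω) a₁ a₂ := fun hc => hS' (conn_symm hc)
    have hxa : Conn ends (restrict ES ω) x a := by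
      have h1 : a ∈ cluster ends (restrict ES ω) x := by
        rw [hTS]; exact Finset.mem_coe.2 haT
      exact h1
    rw [RootCut.cluster_eq_union_root h hR hS (Finset.mem_coe.2 hx) ha hxa, hTS, hRa,
      Finset.coe_union, Finset.coe_insert]
    ext v
    simp only [Set.mem_union, Set.mem_insert_iff, Finset.mem_coe]
    constructor
    · rintro (hv | rfl | hv)
      · exact Or.inl hv
      · exact Or.inl haT
      · exact Or.inr hv
    · rintro (hv | hv)
      · exact Or.inl hv
      · exact Or.inr (Or.inr hv)

omit [Fintype V] [DecidableEq V] [Fintype E] [DecidableEq E] in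
/-- **The fibre of `x` factors (root-free case)**: for `T ⊆ VS`,
`Q ∩ {C(x) = T} = ({C_S(x) = T} ∩ Q)_S ∩ Q_R`. -/
lemma fibre_pair_free (h : RootCut.IsRootCut ends a₁ a₂ ↑VR ↑VS ER ES) {x : V} (hx : x ∈ VS)
    {T : Finset V} (hT : T ⊆ VS) :
    fibre ends a₁ a₂ x T =
      sideEvent ES (clusterEvent ends x (↑T : Set V) ∩ avoidAll ends a₂ {a₁}) ∩
        sideEvent ER (avoidAll ends a₂ {a₁}) := by
  ext ω
  simp only [fibre, Set.mem_inter_iff, mem_sideEvent, RootCut.mem_avoidAll_iff, mem_clusterEvent]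
  constructor
  · rintro ⟨hQ, hWω⟩
    obtain ⟨hR', hS'⟩ := (RootCut.not_conn_iff h).1 hQ
    refine ⟨⟨?_, hS'⟩, hR'⟩
    rw [← cluster_inter_S h hQ hx, hWω]
    exact Set.inter_eq_left.2 fun v hv => Or.inl (hT hv)
  · rintro ⟨⟨hTS, hS'⟩, hR'⟩
    have hQ : ¬ Conn ends ω a₂ a₁ := (RootCut.not_conn_iff h).2 ⟨hR', hS'⟩
    refine ⟨hQ, ?_⟩
    have hR : ¬ Conn ends (restrict ER ω) a₁ a₂ := fun hc => hR' (conn_symm hc)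
    have hS : ¬ Conn ends (restrict ES ω) a₁ a₂ := fun hc => hS' (conn_symm hc)
    have h1 : ¬ Conn ends (restrict ES ω) x a₁ := by
      intro hc
      have h1' : a₁ ∈ cluster ends (restrict ES ω) x := hc
      rw [hTS] at h1'
      exact h.a₁_notS (Finset.mem_coe.2 (hT (Finset.mem_coe.1 h1')))
    have h2 : ¬ Conn ends (restrict ES ω) x a₂ := by
      intro hc
      have h2' : a₂ ∈ cluster ends (restrict ES ω) x := hc
      rw [hTS] at h2'
      exact h.a₂_notS (Finset.mem_coe.2 (hT (Finset.mem_coe.1 h2')))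
    rw [RootCut.cluster_eq_of_not_conn_roots h hR hS (Finset.mem_coe.2 hx) h1 h2, hTS]

omit [Fintype V] [DecidableEq V] [Fintype E] [DecidableEq E] in
/-- A root-free fibre of `x ∈ VS` at a set meeting `VR` is empty. -/
lemma fibre_eq_empty_of_free_inter_VR (h : RootCut.IsRootCut ends a₁ a₂ ↑VR ↑VS ER ES) {x : V}
    (hx : x ∈ VS) {W : Finset V} (h1 : a₁ ∉ W) (h2 : a₂ ∉ W) {v : V} (hv : v ∈ W)
    (hvR : v ∈ VR) : fibre ends a₁ a₂ x W = ∅ := by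
  ext ω
  simp only [fibre, Set.mem_inter_iff, RootCut.mem_avoidAll_iff, mem_clusterEvent,
    Set.mem_empty_iff_false, iff_false, not_and]
  intro hQ hWω
  obtain ⟨hR', hS'⟩ := (RootCut.not_conn_iff h).1 hQ
  have hR : ¬ Conn ends (restrict ER ω) a₁ a₂ := fun hc => hR' (conn_symm hc)
  have hS : ¬ Conn ends (restrict ES ω) a₁ a₂ := fun hc => hS' (conn_symm hc)
  have hxv : Conn ends ω x v := by
    have : v ∈ cluster ends ω x := by rw [hWω]; exact Finset.mem_coe.2 hv
    exact this
  rcases (RootCut.conn_across_iff h hR hS (Finset.mem_coe.2 hx) (Finset.mem_coe.2 hvR)).1 hxv with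
    ⟨hc, _⟩ | ⟨hc, _⟩
  · apply h1
    have : a₁ ∈ cluster ends ω x := conn_mono (restrict_le ES ω) hc
    rw [hWω] at this
    exact Finset.mem_coe.1 this
  · apply h2
    have : a₂ ∈ cluster ends ω x := conn_mono (restrict_le ES ω) hc
    rw [hWω] at this
    exact Finset.mem_coe.1 this

omit [Fintype V] [Fintype E] [DecidableEq E] [DecidablePred (· ∈ ER)] [DecidablePred (· ∈ ES)] in
/-- A fibre of `x ∈ VS` at a set not inside `VS ∪ {a₁, a₂} ∪ VR` is empty. -/
lemma fibre_eq_empty_of_not_subset (h : RootCut.IsRootCut ends a₁ a₂ ↑VR ↑VS ER ES) {x : V}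
    (hx : x ∈ VS) {W : Finset V} (hW : ¬ W ⊆ insert a₁ (insert a₂ VS) ∪ VR) :
    fibre ends a₁ a₂ x W = ∅ := by
  ext ω
  simp only [fibre, Set.mem_inter_iff, mem_clusterEvent, Set.mem_empty_iff_false, iff_false,
    not_and]
  intro _ hWω
  apply hW
  intro v hv
  have hv' : v ∈ cluster ends ω x := by rw [hWω]; exact Finset.mem_coe.2 hv
  rcases cluster_subset_sides h ω hx hv' with hvS | hvR
  · exact Finset.mem_union_left _ (mem_insert_roots_iff.2 hvS)
  · exact Finset.mem_union_right _ (Finset.mem_coe.1 hvR)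

/-- The `R`-side event of the pair `(T, W_R)`: `{C_R(a) = insert a W_R} ∩ Q` for the root `a ∈ T`
(`a₁` first), `Q` if `T` has no root and `W_R = ∅`, empty otherwise. -/
def RE (ends : E → Sym2 V) (a₁ a₂ : V) (T W_R : Finset V) : Set (Config E) :=
  if a₁ ∈ T then clusterEvent ends a₁ (↑(insert a₁ W_R) : Set V) ∩ avoidAll ends a₂ {a₁}
  else if a₂ ∈ T then clusterEvent ends a₂ (↑(insert a₂ W_R) : Set V) ∩ avoidAll ends a₂ {a₁}
  else if W_R = ∅ then avoidAll ends a₂ {a₁} else ∅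

omit [Fintype V] [Fintype E] [DecidableEq E] [DecidablePred (· ∈ ER)] [DecidablePred (· ∈ ES)] in
/-- `RE T W_R ⊆ Q`. -/
lemma RE_subset_Q (T W_R : Finset V) : RE ends a₁ a₂ T W_R ⊆ avoidAll ends a₂ {a₁} := by
  unfold RE
  split_ifs
  · exact Set.inter_subset_right
  · exact Set.inter_subset_right
  · exact le_rfl
  · exact Set.empty_subset _

omit [Fintype V] [Fintype E] [DecidableEq E] in
/-- **The fibre of `x` on a pair**: for `T ⊆ VS ∪ {a₁, a₂}` and `W_R ⊆ VR`,
`Q ∩ {C(x) = T ∪ W_R} = ({C_S(x) = T} ∩ Q)_S ∩ (RE T W_R)_R`. -/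
lemma fibre_pair (h : RootCut.IsRootCut ends a₁ a₂ ↑VR ↑VS ER ES) {x : V} (hx : x ∈ VS)
    {T : Finset V} (hT : T ⊆ insert a₁ (insert a₂ VS)) {W_R : Finset V} (hW : W_R ⊆ VR) :
    fibre ends a₁ a₂ x (T ∪ W_R) =
      sideEvent ES (clusterEvent ends x (↑T : Set V) ∩ avoidAll ends a₂ {a₁}) ∩
        sideEvent ER (RE ends a₁ a₂ T W_R) := by
  unfold RE
  split_ifs with h1 h2 h3
  · exact fibre_pair_root h hx hT hW (Or.inl rfl) h1
  · exact fibre_pair_root h hx hT hW (Or.inr rfl) h2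
  · subst h3
    rw [Finset.union_empty]
    refine fibre_pair_free h hx fun v hv => ?_
    rcases Finset.mem_insert.1 (hT hv) with rfl | hv'
    · exact absurd hv h1
    rcases Finset.mem_insert.1 hv' with rfl | hv''
    · exact absurd hv h2
    · exact hv''
  · obtain ⟨v, hv⟩ := Finset.nonempty_iff_ne_empty.2 h3
    rw [sideEvent_empty, Set.inter_empty]
    refine fibre_eq_empty_of_free_inter_VR h hx ?_ ?_ (Finset.mem_union_right T hv) (hW hv)
    · intro hc
      rcases Finset.mem_union.1 hc with hc | hc
      · exact h1 hc
      · exact h.a₁_notR (Finset.mem_coe.2 (hW hc))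
    · intro hc
      rcases Finset.mem_union.1 hc with hc | hc
      · exact h2 hc
      · exact h.a₂_notR (Finset.mem_coe.2 (hW hc))

omit [Fintype V] [Fintype E] [DecidableEq E] in
/-- A fibre of `x` on a pair meets `{r ↔ y}`, `r, y` on the `S`-side, inside the `S`-factor. -/
lemma fibre_pair_inter_conn_S (h : RootCut.IsRootCut ends a₁ a₂ ↑VR ↑VS ER ES) {x : V}
    (hx : x ∈ VS) {T : Finset V} (hT : T ⊆ insert a₁ (insert a₂ VS)) {W_R : Finset V}
    (hW : W_R ⊆ VR) {r y : V} (hr : r ∈ (↑VS : Set V) ∪ {a₁, a₂})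
    (hy : y ∈ (↑VS : Set V) ∪ {a₁, a₂}) :
    fibre ends a₁ a₂ x (T ∪ W_R) ∩ connEvent ends r y =
      sideEvent ES (clusterEvent ends x (↑T : Set V) ∩
          (avoidAll ends a₂ {a₁} ∩ connEvent ends r y)) ∩
        sideEvent ER (RE ends a₁ a₂ T W_R) := by
  rw [fibre_pair h hx hT hW]
  have key := Set.ext_iff.1 (RootCut.avoidAll_inter_conn_S_eq h hr hy)
  have hQω := Set.ext_iff.1 (RootCut.avoidAll_eq_inter_sideEvent h)
  ext ω
  have key' := key ω
  have hQ' := hQω ω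
  simp only [Set.mem_inter_iff, mem_sideEvent] at key' hQ' ⊢
  constructor
  · rintro ⟨⟨⟨h1, h2⟩, h3⟩, h4⟩
    have hQ : ω ∈ avoidAll ends a₂ {a₁} := hQ'.2 ⟨RE_subset_Q T W_R h3, h2⟩
    exact ⟨⟨h1, h2, (key'.1 ⟨hQ, h4⟩).2.2⟩, h3⟩
  · rintro ⟨⟨h1, h2, h5⟩, h3⟩
    exact ⟨⟨⟨h1, h2⟩, h3⟩, (key'.2 ⟨RE_subset_Q T W_R h3, h2, h5⟩).2⟩

omit [Fintype V] [Fintype E] [DecidableEq E] in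
/-- A fibre of `x` on a pair meets `{r ↔ y}`, `r, y` on the `R`-side, inside the `R`-factor. -/
lemma fibre_pair_inter_conn_R (h : RootCut.IsRootCut ends a₁ a₂ ↑VR ↑VS ER ES) {x : V}
    (hx : x ∈ VS) {T : Finset V} (hT : T ⊆ insert a₁ (insert a₂ VS)) {W_R : Finset V}
    (hW : W_R ⊆ VR) {r y : V} (hr : r ∈ (↑VR : Set V) ∪ {a₁, a₂})
    (hy : y ∈ (↑VR : Set V) ∪ {a₁, a₂}) :
    fibre ends a₁ a₂ x (T ∪ W_R) ∩ connEvent ends r y =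
      sideEvent ES (clusterEvent ends x (↑T : Set V) ∩ avoidAll ends a₂ {a₁}) ∩
        sideEvent ER (RE ends a₁ a₂ T W_R ∩ connEvent ends r y) := by
  rw [fibre_pair h hx hT hW]
  have key := Set.ext_iff.1 (RootCut.avoidAll_inter_conn_R_eq h hr hy)
  have hQω := Set.ext_iff.1 (RootCut.avoidAll_eq_inter_sideEvent h)
  ext ω
  have key' := key ω
  have hQ' := hQω ω
  simp only [Set.mem_inter_iff, mem_sideEvent] at key' hQ' ⊢
  constructor
  · rintro ⟨⟨⟨h1, h2⟩, h3⟩, h4⟩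
    have hQ : ω ∈ avoidAll ends a₂ {a₁} := hQ'.2 ⟨RE_subset_Q T W_R h3, h2⟩
    exact ⟨⟨h1, h2⟩, h3, (key'.1 ⟨hQ, h4⟩).1.2⟩
  · rintro ⟨⟨h1, h2⟩, h3, h5⟩
    exact ⟨⟨⟨h1, h2⟩, h3⟩, (key'.2 ⟨⟨RE_subset_Q T W_R h3, h5⟩, h2⟩).2⟩

end Fibres

/-! ## Probabilities and the partitions -/

section Probabilities

variable {V : Type*} {E : Type*} [Fintype V] [DecidableEq V] [Fintype E] [DecidableEq E]
  {R : Type*} [CommRing R] {ends : E → Sym2 V} {a₁ a₂ : V} {VR VS : Finset V} {ER ES : Set E}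
  [DecidablePred (· ∈ ER)] [DecidablePred (· ∈ ES)] (p : E → R)

omit [Fintype V] in
/-- The fibre mass on a pair factors. -/
lemma prob_fibre_pair (h : RootCut.IsRootCut ends a₁ a₂ ↑VR ↑VS ER ES) {x : V} (hx : x ∈ VS)
    {T : Finset V} (hT : T ⊆ insert a₁ (insert a₂ VS)) {W_R : Finset V} (hW : W_R ⊆ VR) :
    mW p ends a₁ a₂ x (T ∪ W_R) =
      prob p (sideEvent ES (clusterEvent ends x (↑T : Set V) ∩ avoidAll ends a₂ {a₁})) *
        prob p (sideEvent ER (RE ends a₁ a₂ T W_R)) := by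
  unfold mW
  rw [fibre_pair h hx hT hW]
  exact RootCut.prob_sideEvent_inter_eq_mul p h.symm _ _

omit [Fintype V] in
/-- A fibre–connection mass on a pair factors, the connection on the `S`-side. -/
lemma prob_fibre_pair_inter_S (h : RootCut.IsRootCut ends a₁ a₂ ↑VR ↑VS ER ES) {x : V}
    (hx : x ∈ VS) {T : Finset V} (hT : T ⊆ insert a₁ (insert a₂ VS)) {W_R : Finset V}
    (hW : W_R ⊆ VR) {r y : V} (hr : r ∈ (↑VS : Set V) ∪ {a₁, a₂})
    (hy : y ∈ (↑VS : Set V) ∪ {a₁, a₂}) :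
    prob p (fibre ends a₁ a₂ x (T ∪ W_R) ∩ connEvent ends r y) =
      prob p (sideEvent ES (clusterEvent ends x (↑T : Set V) ∩
          (avoidAll ends a₂ {a₁} ∩ connEvent ends r y))) *
        prob p (sideEvent ER (RE ends a₁ a₂ T W_R)) := by
  rw [fibre_pair_inter_conn_S h hx hT hW hr hy]
  exact RootCut.prob_sideEvent_inter_eq_mul p h.symm _ _

omit [Fintype V] in
/-- A fibre–connection mass on a pair factors, the connection on the `R`-side. -/
lemma prob_fibre_pair_inter_R (h : RootCut.IsRootCut ends a₁ a₂ ↑VR ↑VS ER ES) {x : V}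
    (hx : x ∈ VS) {T : Finset V} (hT : T ⊆ insert a₁ (insert a₂ VS)) {W_R : Finset V}
    (hW : W_R ⊆ VR) {r y : V} (hr : r ∈ (↑VR : Set V) ∪ {a₁, a₂})
    (hy : y ∈ (↑VR : Set V) ∪ {a₁, a₂}) :
    prob p (fibre ends a₁ a₂ x (T ∪ W_R) ∩ connEvent ends r y) =
      prob p (sideEvent ES (clusterEvent ends x (↑T : Set V) ∩ avoidAll ends a₂ {a₁})) *
        prob p (sideEvent ER (RE ends a₁ a₂ T W_R ∩ connEvent ends r y)) := by
  rw [fibre_pair_inter_conn_R h hx hT hW hr hy]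
  exact RootCut.prob_sideEvent_inter_eq_mul p h.symm _ _

omit [DecidablePred (· ∈ ES)] in
/-- **Partition on the `R`-side**: for every `T`, the events `RE T W_R`, `W_R ⊆ VR`, partition `Q_R`
(intersected with any event `X`). -/
lemma sum_prob_RE_inter (h : RootCut.IsRootCut ends a₁ a₂ ↑VR ↑VS ER ES) (T : Finset V)
    (X : Set (Config E)) :
    ∑ W_R ∈ VR.powerset, prob p (sideEvent ER (RE ends a₁ a₂ T W_R ∩ X)) =
      prob p (sideEvent ER (avoidAll ends a₂ {a₁} ∩ X)) := by
  have hvan : ∀ (a : V) (W : Finset V), a ∉ W →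
      prob p (sideEvent ER (clusterEvent ends a (↑W : Set V) ∩ avoidAll ends a₂ {a₁} ∩ X)) = 0 := by
    intro a W haW
    rw [clusterEvent_x_eq_empty_of_notMem haW, Set.empty_inter, Set.empty_inter, sideEvent_empty,
      prob_empty]
  unfold RE
  by_cases h1 : a₁ ∈ T
  · simp only [if_pos h1]
    rw [← sum_powerset_insert_eq a₁ VR (fun hc => h.a₁_notR (Finset.mem_coe.2 hc))
      (fun W => prob p (sideEvent ER (clusterEvent ends a₁ (↑W : Set V) ∩ avoidAll ends a₂ {a₁} ∩ X)))
      (hvan a₁)]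
    simp_rw [Set.inter_assoc]
    refine sum_prob_sideEvent_cluster_inter p ER a₁ (insert a₁ VR) _ fun ω hω => ?_
    rw [cluster_R_root_eq h (RootCut.mem_avoidAll_iff.1 hω.1) (Or.inl rfl), Finset.coe_insert]
    exact Set.insert_subset_insert Set.inter_subset_right
  · simp only [if_neg h1]
    by_cases h2 : a₂ ∈ T
    · simp only [if_pos h2]
      rw [← sum_powerset_insert_eq a₂ VR (fun hc => h.a₂_notR (Finset.mem_coe.2 hc))
        (fun W => prob p (sideEvent ER (clusterEvent ends a₂ (↑W : Set V) ∩ avoidAll ends a₂ {a₁} ∩ X)))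
        (hvan a₂)]
      simp_rw [Set.inter_assoc]
      refine sum_prob_sideEvent_cluster_inter p ER a₂ (insert a₂ VR) _ fun ω hω => ?_
      rw [cluster_R_root_eq h (RootCut.mem_avoidAll_iff.1 hω.1) (Or.inr rfl), Finset.coe_insert]
      exact Set.insert_subset_insert Set.inter_subset_right
    · simp only [if_neg h2]
      rw [Finset.sum_eq_single (∅ : Finset V)]
      · simp only [if_true]
      · intro W _ hW
        rw [if_neg hW, Set.empty_inter, sideEvent_empty, prob_empty]
      · intro hc
        exact absurd (Finset.empty_mem_powerset VR) hc

omit [DecidablePred (· ∈ ER)] in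
/-- **Partition on the `S`-side**: the cluster events `{C_S(x) = T}`, `T ⊆ VS ∪ {a₁, a₂}`, partition
every `S`-side event. -/
lemma sum_prob_S_cluster_inter (h : RootCut.IsRootCut ends a₁ a₂ ↑VR ↑VS ER ES) {x : V}
    (hx : x ∈ VS) (Z : Set (Config E)) :
    ∑ T ∈ (insert a₁ (insert a₂ VS)).powerset,
        prob p (sideEvent ES (clusterEvent ends x (↑T : Set V) ∩ Z)) =
      prob p (sideEvent ES Z) :=
  sum_prob_sideEvent_cluster_inter p ES x _ Z fun ω _ v hv => by
    rw [Finset.mem_coe, mem_insert_roots_iff]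
    exact RootCut.cluster_restrict_subset_S h (Or.inl (Finset.mem_coe.2 hx)) hv

omit [Fintype V] [Fintype E] [DecidableEq E] [DecidablePred (· ∈ ER)] [DecidablePred (· ∈ ES)] in
/-- `s3` of a pair is `s3` of its `S`-part. -/
lemma s3_union_R (h : RootCut.IsRootCut ends a₁ a₂ ↑VR ↑VS ER ES) (T : Finset V) {W_R : Finset V}
    (hW : W_R ⊆ VR) : (s3 a₁ a₂ (T ∪ W_R) : R) = s3 a₁ a₂ T := by
  have h1 : a₁ ∉ W_R := fun hc => h.a₁_notR (Finset.mem_coe.2 (hW hc))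
  have h2 : a₂ ∉ W_R := fun hc => h.a₂_notR (Finset.mem_coe.2 (hW hc))
  simp only [s3, Finset.mem_union, h1, h2, or_false]

end Probabilities

end RootShield

end A3Fibre

end CovForm

end Summit.Ventures.PercRepro2
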